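import Mathlib.NumberTheory.Padics.Complex
import Literature.NumberTheory.EllipticCurves.Rank1Residual.Predicates
import Literature.NumberTheory.EllipticCurves.ModularCurve
import HarnessLib

/-!
# Ihara's lemma modulo `2`, read on Manin-symbol functions (absolutely irreducible case)

Topic `NumberTheory/EllipticCurves`; namespace `Literature.NumberTheory.EllipticCurves`. ONE named fact (`def … : Prop`,
nothing asserted, D-0014), statement-only, typed by the lead prover seat `bsd-wall-tp2-p1` g11 of cell `bsd-wall` for the BSD crux
`MazurTateCongruenceAtTwoTop` (route ThetaPartnerAtTwo, stmt-BirchSwinnertonDyer-25797, skeleton `symbol` v6, stub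
`stub_iharaSymbolModTwoNegDisc`), where it is the ONLY input that is neither a previously typed print fact nor a landed theorem:
consumer `Summits/…/Theorems/ThetaPartnerAtTwoMazurTateCongruenceAtTwoTopOfIhara.lean`
(`mazurTateCongruenceAtTwoTop_of_fourFacts_ihara`). It enters through the landed implication
`stub_depletionPrimitiveNegDisc_of_ihara` («depletion at odd places preserves the existence of a `2`-adic unit value of the
Néron-normalised plus symbol»).

## Sources (read; page = PDF page)

* K. A. Ribet, *Congruence relations between modular forms*, Proc. ICM Warszawa 1983, PWN (1984) 503–514 [Ribet1984ICM], §4: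
  **Theorem 4.1, Corollary 4.2, Theorem 4.3** — for a prime `M ∤ N`, the kernel of the degeneracy map `J₀(N) × J₀(N) → J₀(NM)` is
  the antidiagonally embedded Shimura subgroup; the proof is «for all prime numbers `l`» and rests on Ihara's lemma
  (Y. Ihara, *On modular curves over finite fields*, 1975, Lemma 3.2) = the congruence-subgroup property of `SL₂(ℤ[1/M])`.
* J. Manning, J. Shotton, *Ihara's Lemma for Shimura curves over totally real fields via patching*, Math. Ann. 379 (2021)
  (held: arXiv:1907.06043), p. 2, **Theorem (Ihara's Lemma)**: «Let `Γ = Γ₀(N)` […] and let `p` be a prime not dividing `N`. Write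
  `Γ' = Γ ∩ Γ₀(p)`. […] If `l` is another prime, then we have a map `π* = π₁* + π₂* : H¹(X_Γ, 𝔽_l)² → H¹(X_Γ', 𝔽_l)`. As a consequence of
  a result of Ihara — [Ihara 1975] Lemma 3.2, and see also the proof of [Ribet 1984] Theorem 4.1 — the kernel of `π*` may be determined.
  In particular: Theorem (Ihara's Lemma). If `𝔪` is a non-Eisenstein maximal ideal of the Hecke algebra acting on these cohomology groups
  (that is, `𝔪` corresponds to an irreducible Galois representation), then the map `π*` is injective after localizing at `𝔪`.»
  (ANY prime `l`, in particular `l = 2`.)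
* J.-P. Serre, *Le problème des groupes de congruence pour SL₂*, Ann. Math. 92 (1970) [Serre1970SL2], Thm. 2 (congruence-subgroup
  property of `SL₂(ℤ[1/ℓ])`) and *Trees* II.1.4 (`SL₂(ℤ[1/ℓ]) = SL₂(ℤ) *_{Γ₀(ℓ)} SL₂(ℤ)^a`).
* Ju. I. Manin, *Parabolic points and zeta functions of modular curves* (1972) [Manin1972], Thm. 1.9 (Manin symbols).

## The tree's reading (ASSEMBLED — the following steps are NOT verbatim in print)

The tree has no `H¹(X₀(N), 𝔽₂)` with its Hecke action; routes ResidualThetaTransportAtTwo / ThetaPartnerAtTwo work with SYMBOL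
FUNCTIONS `Φ : ℚ → ℚ̄₂` (values of Néron-normalised, Euler-depleted plus modular symbols), cf. the hypotheses of the landed
`plusLineCharTwo_of_fourFacts`. The dictionary: a `1`-periodic function `Φ : ℚ → 𝒪_{ℚ̄₂}` satisfying Manin's relation
`Φ(γr) = Φ(γ∞) + Φ(r)` for `γ ∈ Γ₀(N')` (with `Φ(∞) := 0`) is the same as an `𝒪_{ℚ̄₂}`-valued weight-`2` modular symbol
`{x → y} ↦ Φ(y) − Φ(x)` for `Γ₀(N')` [Manin1972]; its reduction mod `𝔪` lies in `Symb_{Γ₀(N')}(𝔽̄₂)`, which maps Hecke-equivariantly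
to `H¹(Γ₀(N'), 𝔽̄₂)` with kernel the boundary (cusp) symbols. (1) If `Φ` is moreover `ℤ[1/ℓ]`-translation invariant mod `𝔪`, its
reduction is invariant under `⟨Γ₀(N'), (1 x; 0 1) : x ∈ ℤ[1/ℓ]⟩`, which is the FULL `ℓ`-arithmetic group
`{γ ∈ SL₂(ℤ[1/ℓ]) : c ∈ N'ℤ[1/ℓ]}` (for `ℓ ∤ N'`: it contains `a⁻¹Γ₀(N')a`, `a = diag(ℓ,1)`, and two adjacent vertex stabilisers of the
Bruhat–Tits tree generate, Serre *Trees* II.1.4 — this is exactly the pair `(Φ̄, Φ̄)` lying in `ker π*`; for `ℓ ∣ N'`: the shifted path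
stabilisers `a^{-k}Γ₀(N')a^k`, `k ≥ 0`, generate the same group). (2) By the congruence-subgroup property [Serre1970SL2] the class of `Φ̄`
in `H¹` factors through a congruence quotient, so `T_q` acts on it — and on the boundary symbols of `Γ₀(N')` — by `q + 1 ≡ 0 (mod 2)` for
all primes `q ≡ 1` modulo a fixed modulus (Ribet's argument). (3) For an elliptic curve `W` good supersingular at `2` with `Δ_W < 0`,
`W[2]` has Galois image `S₃` (irreducible: no rational `2`-torsion; not inside `A₃`: `Δ_W` is not a square), so `ρ̄_{W,2}` is ABSOLUTELY
irreducible, the ideal `𝔪 = (2, T_q − a_q(W))` is non-Eisenstein, and Chebotarev supplies primes `q ≡ 1` (any modulus) with `a_q(W)` odd;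
the Hecke congruence `T_qΦ ≡ a_q(W)Φ` then forces `Φ̄ = 0`. (`Δ_W < 0` cannot be dropped: for a `C₃` image the mod-`2` system
`χ + χ²` IS Eisenstein.) `TODO(general form)`: the printed statement is the injectivity of `π*` on `H¹(X₀(N), 𝔽_l)_𝔪` for every prime
`l` and every non-Eisenstein `𝔪`; this reading fixes `l = 2`, weight `2`, trivial character, the eigen-system of an elliptic curve, and the
symbol-function language, and includes the case `ℓ ∣ N'`. Weaker hypotheses than needed are allowed (evenness is not used).
Nothing is asserted; no `_holds`. BSD is not proved by this.
-/

noncomputable section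

open scoped MatrixGroups ModularForm NumberField

open CongruenceSubgroup IsDedekindDomain Literature.NumberTheory.EllipticCurves.Rank1Residual

namespace Literature.NumberTheory.EllipticCurves

/-- **Ihara's lemma mod `2`, read on Manin-symbol functions (absolutely irreducible case)** — Ribet, Proc. ICM 1983, Thm. 4.1 /
Cor. 4.2 / Thm. 4.3 (kernel of `J₀(N)² → J₀(NM)` = antidiagonal Shimura subgroup, «for all primes `l`», via Ihara 1975 Lemma 3.2),
in the form of Manning–Shotton 2021, Thm. «Ihara's Lemma» (p. 2): «`π* = π₁* + π₂* : H¹(X_{Γ₀(N)}, 𝔽_l)² → H¹(X_{Γ₀(N)∩Γ₀(p)}, 𝔽_l)` […]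
If `𝔪` is a non-Eisenstein maximal ideal […] then `π*` is injective after localizing at `𝔪`» (any prime `l`; here `l = 2`). READ
(assembled, module docstring steps (1)–(3): Manin symbols, Serre's congruence-subgroup property for `SL₂(ℤ[1/ℓ])`, Chebotarev) as:
for `W/ℚ` globally minimal elliptic, good supersingular at `2` with `Δ_W < 0` (so `ρ̄_{W,2}` has image `S₃`, non-Eisenstein), an odd
level `N'` off which `W` has good reduction, an odd prime `ℓ`, and a function `Φ : ℚ → ℚ̄₂` that is `1`-periodic, even, satisfies Manin's
`Γ₀(N')`-relation, is `2`-integral, and is Hecke-congruent modulo the maximal ideal to `a_q(W) = W.LFunction q` at every prime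
`q ∤ 2N'ℓ`: if `Φ` is `ℤ[1/ℓ]`-translation invariant modulo the maximal ideal (`‖Φ(r + j/ℓⁿ) − Φ(r)‖ < 1`), then `Φ ≡ 0` modulo the
maximal ideal (`‖Φ(r)‖ < 1` for all `r`). Consumer: BSD crux `MazurTateCongruenceAtTwoTop` (stub `stub_iharaSymbolModTwoNegDisc`).
Size M as a port of Ribet's proof; cite-grade as stated. Nothing asserted; no `_holds`.
[cite: Ribet1984ICM, Thm. 4.1, Cor. 4.2 and Thm. 4.3] [cite: Serre1970SL2, Thm. 2] [cite: Manin1972, Thm. 1.9] -/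
def ribet1984_ihara_modTwo_symbolForm : Prop :=
    ∀ (W : WeierstrassCurve ℚ) [W.IsElliptic] [W.IsGloballyMinimal], GoodSS W 2 → W.Δ < 0 → ∀ (N' : ℕ), Odd N' →
      (∀ v : IsDedekindDomain.HeightOneSpectrum (NumberField.RingOfIntegers ℚ), ¬ ((Rat.HeightOneSpectrum.primesEquiv v : ℕ) ∣ 2 * N') → W.HasGoodReductionAt v) →
      ∀ (ℓ : ℕ), ℓ.Prime → ℓ ≠ 2 → ∀ (Φ : ℚ → PadicAlgCl 2),
      (∀ (r : ℚ) (z : ℤ), Φ (r + z) = Φ r) → (∀ r : ℚ, Φ (-r) = Φ r) → (∀ (γ : CongruenceSubgroup.Gamma0 (N')) (r : ℚ), ((γ : SL(2, ℤ)) 1 0 : ℚ) * r + ((γ : SL(2, ℤ)) 1 1 : ℚ) ≠ 0 → Φ ((((γ : SL(2, ℤ)) 0 0 : ℚ) * r + ((γ : SL(2, ℤ)) 0 1 : ℚ)) / (((γ : SL(2, ℤ)) 1 0 : ℚ) * r + ((γ : SL(2, ℤ)) 1 1 : ℚ))) = (if ((γ : SL(2, ℤ)) 1 0) = 0 then 0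 else Φ ((((γ : SL(2, ℤ)) 0 0 : ℚ)) / (((γ : SL(2, ℤ)) 1 0 : ℚ)))) + Φ r) →
      (∀ r : ℚ, ‖Φ r‖ ≤ 1) →
      (∀ q : ℕ, q.Prime → ¬ q ∣ 2 * N' * ℓ → ∀ r : ℚ, ‖(∑ j : Fin q, Φ ((r + j) / q)) + Φ (q * r) - (W.LFunction q : PadicAlgCl 2) * Φ r‖ < 1) →
      (∀ (r : ℚ) (j : ℤ) (n : ℕ), ‖Φ (r + j / (ℓ : ℚ) ^ n) - Φ r‖ < 1) →
      ∀ r : ℚ, ‖Φ r‖ < 1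

end Literature.NumberTheory.EllipticCurves

end
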